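import Mathlib
import Summits.Ventures.PercRepro2.Defs
import Summits.Ventures.PercRepro2.Independence
import Summits.Ventures.PercRepro2.Harris
import Summits.Ventures.PercRepro2.Graph
import Summits.Ventures.PercRepro2.Events
import Summits.Ventures.PercRepro2.ZCK4PolyRefl
import Summits.Ventures.PercRepro2.ZCK4DataCells
import Summits.Ventures.PercRepro2.ZCK4DataFlowA
import Summits.Ventures.PercRepro2.ZCK4DataFlowB
import Summits.Ventures.PercRepro2.ZCK4Pieces
import Summits.Ventures.PercRepro2.ZCK4Table
import Summits.Ventures.PercRepro2.ZCK4Cells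

/-!
# (ZC) on `K₄` — every weight vector, every cluster up-set (blind cell PercRepro2, mine-a g27)

The complete graph `K₄` is the first graph with no kernel dismantling of (ZC) for any placement of the marks
(every vertex has degree 3).  Here (ZC) is proved on it for the marks `a₁ = 0`, `a₃ = 1`, `o = 2` (the
fourth vertex `3` is not a mark; every other placement is this one up to relabelling), for every weight
vector and every cluster up-set, by the FLOW CERTIFICATE: writing `y_S := 𝓔.indicator 1 ({0} ∪ S)` for
`S ⊆ {1, 2, 3}`, the (ZC) expression equals `∑_{S ⋖ T} λ_{ST}(p, 1 - p) · (y_T - y_S)` with the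
nonnegative polynomials `λ` of `ZCK4DataFlowA/B` — each summand is `≥ 0` because `λ ≥ 0` on `[0, 1]^6`
and `y_S ≤ y_T` for an up-set.  The eight coefficient identities are kernel computations (`ZCK4Pieces`);
the cell probabilities are the explicit polynomials of `ZCK4Cells`.  With the zero-weight reroute of
`ZCReroute`, every simple graph on at most four vertices is `K₄` with some weights `0`.
-/

namespace Summit.Ventures.PercRepro2

section Mono

variable {R : Type*} [CommRing R] [PartialOrder R] [IsOrderedRing R]

/-- The indicator of an up-set is monotone. -/
lemma indicator_one_mono_of_isUpperSet {V : Type*} {𝓔 : Set (Set V)} (h𝓔 : IsUpperSet 𝓔) {S T : Set V}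
    (hST : S ⊆ T) : 𝓔.indicator (1 : Set V → R) S ≤ 𝓔.indicator 1 T := by
  by_cases hS : S ∈ 𝓔
  · have hT : T ∈ 𝓔 := h𝓔 hST hS
    simp [Set.indicator_of_mem hS, Set.indicator_of_mem hT]
  · simp only [Set.indicator_of_notMem hS]
    exact Set.indicator_nonneg (fun _ _ => zero_le_one) _

/-- The valuation `p 0, 1 - p 0, …, p 5, 1 - p 5` is nonnegative for a probability vector. -/
lemma k4Rho_nonneg {p : Fin 6 → R} (hp : IsProbVec p) : ∀ i, 0 ≤ (fun i => ([p 0, 1 - p 0, p 1, 1 - p 1, p 2, 1 - p 2, p 3, 1 - p 3, p 4, 1 - p 4, p 5, 1 - p 5] : List R).getD i 0) i := by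
  intro i
  have h0 := hp.nonneg; have h1 := fun e => sub_nonneg.2 (hp.le_one e)
  match i with
  | 0 => exact h0 0
  | 1 => exact h1 0
  | 2 => exact h0 1
  | 3 => exact h1 1
  | 4 => exact h0 2
  | 5 => exact h1 2
  | 6 => exact h0 3
  | 7 => exact h1 3
  | 8 => exact h0 4
  | 9 => exact h1 4
  | 10 => exact h0 5
  | 11 => exact h1 5
  | n + 12 => simp

end Mono

/-- **(ZC) on `K₄`** with the marks `a₁ = 0`, `a₃ = 1`, `o = 2` (the vertex `3` is not a mark): for every
weight vector `p ∈ [0, 1]^6` and every cluster up-set `𝓔`,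
`P(D) · Cov(U, e ∩ L) ≥ P(B) · Cov(U, e ∩ Lᶜ)` — the first kernel instance of (ZC) on a graph of minimum
degree three. -/
theorem zc_k4 {R : Type*} [CommRing R] [LinearOrder R] [IsStrictOrderedRing R]
    {p : Fin 6 → R} (hp : IsProbVec p) {𝓔 : Set (Set (Fin 4))} (h𝓔 : IsUpperSet 𝓔) :
    let ends : Fin 6 → Sym2 (Fin 4) := ![s(0, 1), s(0, 2), s(0, 3), s(1, 2), s(1, 3), s(2, 3)]
    let e := connEvent ends 0 1
    let L' := connEvent ends 0 2
    let U := clusterInEvent ends 0 𝓔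
    let γ := connEvent ends 1 2
    0 ≤ prob p (eᶜ ∩ L'ᶜ ∩ γᶜ) * (prob p (U ∩ (e ∩ L')) - prob p U * prob p (e ∩ L'))
      - prob p (eᶜ ∩ L'ᶜ ∩ γ) * (prob p (U ∩ (e ∩ L'ᶜ)) - prob p U * prob p (e ∩ L'ᶜ)) := by
  intro ends e L' U γ
  simp only [ends, e, L', U, γ]
  rw [k4_prob_D, k4_prob_UeL, k4_prob_U, k4_prob_eL, k4_prob_B, k4_prob_UenL, k4_prob_enL]
  set ρ : ℕ → R := fun i => ([p 0, 1 - p 0, p 1, 1 - p 1, p 2, 1 - p 2, p 3, 1 - p 3, p 4, 1 - p 4, p 5, 1 - p 5] : List R).getD i 0 with hρ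
  have hρ0 : ∀ i, 0 ≤ ρ i := k4Rho_nonneg hp
  have hONE : PolyRefl.eval ρ K4.k4ONE = 1 := k4_eval_ONE p
  set y0 : R := 𝓔.indicator 1 ({0} : Set (Fin 4)) with hy0
  set y1 : R := 𝓔.indicator 1 ({0, 1} : Set (Fin 4)) with hy1
  set y2 : R := 𝓔.indicator 1 ({0, 2} : Set (Fin 4)) with hy2
  set y3 : R := 𝓔.indicator 1 ({0, 3} : Set (Fin 4)) with hy3
  set y12 : R := 𝓔.indicator 1 ({0, 1, 2} : Set (Fin 4)) with hy12
  set y13 : R := 𝓔.indicator 1 ({0, 1, 3} : Set (Fin 4)) with hy13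
  set y23 : R := 𝓔.indicator 1 ({0, 2, 3} : Set (Fin 4)) with hy23
  set y123 : R := 𝓔.indicator 1 ({0, 1, 2, 3} : Set (Fin 4)) with hy123
  have h0 := K4.k4_piece_0 ρ
  have h1 := K4.k4_piece_1 ρ
  have h2 := K4.k4_piece_2 ρ
  have h3 := K4.k4_piece_3 ρ
  have h12 := K4.k4_piece_12 ρ
  have h13 := K4.k4_piece_13 ρ
  have h23 := K4.k4_piece_23 ρ
  have h123 := K4.k4_piece_123 ρ
  simp only [hONE] at h0 h1 h2 h3 h12 h13 h23 h123
  have hl_0_1 : 0 ≤ PolyRefl.eval ρ K4.k4Lam_0_1 :=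
    PolyRefl.eval_nonneg _ hρ0 _ (by decide +kernel)
  have hl_1_12 : 0 ≤ PolyRefl.eval ρ K4.k4Lam_1_12 :=
    PolyRefl.eval_nonneg _ hρ0 _ (by decide +kernel)
  have hl_2_12 : 0 ≤ PolyRefl.eval ρ K4.k4Lam_2_12 :=
    PolyRefl.eval_nonneg _ hρ0 _ (by decide +kernel)
  have hl_3_13 : 0 ≤ PolyRefl.eval ρ K4.k4Lam_3_13 :=
    PolyRefl.eval_nonneg _ hρ0 _ (by decide +kernel)
  have hl_12_123 : 0 ≤ PolyRefl.eval ρ K4.k4Lam_12_123 :=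
    PolyRefl.eval_nonneg _ hρ0 _ (by decide +kernel)
  have hl_13_123 : 0 ≤ PolyRefl.eval ρ K4.k4Lam_13_123 :=
    PolyRefl.eval_nonneg _ hρ0 _ (by decide +kernel)
  have hl_23_123 : 0 ≤ PolyRefl.eval ρ K4.k4Lam_23_123 :=
    PolyRefl.eval_nonneg _ hρ0 _ (by decide +kernel)
  have hy_0_1 : y0 ≤ y1 :=
    indicator_one_mono_of_isUpperSet h𝓔
      (by simp only [Set.subset_def, Set.mem_insert_iff, Set.mem_singleton_iff]; decide)
  have hy_1_12 : y1 ≤ y12 :=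
    indicator_one_mono_of_isUpperSet h𝓔
      (by simp only [Set.subset_def, Set.mem_insert_iff, Set.mem_singleton_iff]; decide)
  have hy_2_12 : y2 ≤ y12 :=
    indicator_one_mono_of_isUpperSet h𝓔
      (by simp only [Set.subset_def, Set.mem_insert_iff, Set.mem_singleton_iff]; decide)
  have hy_3_13 : y3 ≤ y13 :=
    indicator_one_mono_of_isUpperSet h𝓔
      (by simp only [Set.subset_def, Set.mem_insert_iff, Set.mem_singleton_iff]; decide)
  have hy_12_123 : y12 ≤ y123 :=
    indicator_one_mono_of_isUpperSet h𝓔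
      (by simp only [Set.subset_def, Set.mem_insert_iff, Set.mem_singleton_iff]; decide)
  have hy_13_123 : y13 ≤ y123 :=
    indicator_one_mono_of_isUpperSet h𝓔
      (by simp only [Set.subset_def, Set.mem_insert_iff, Set.mem_singleton_iff]; decide)
  have hy_23_123 : y23 ≤ y123 :=
    indicator_one_mono_of_isUpperSet h𝓔
      (by simp only [Set.subset_def, Set.mem_insert_iff, Set.mem_singleton_iff]; decide)
  have key : PolyRefl.eval ρ K4.k4PD * ((y12 * PolyRefl.eval ρ K4.k4PS12 + y123 * PolyRefl.eval ρ K4.k4PS123) - (y0 * PolyRefl.eval ρ K4.k4PS0 + y1 * PolyRefl.eval ρ K4.k4PS1 + y2 * PolyRefl.eval ρ K4.k4PS2 + y3 * PolyRefl.eval ρ K4.k4PS3 + y12 * PolyRefl.eval ρ K4.k4PS12 + y13 * PolyRefl.eval ρ K4.k4PS13 + y23 * PolyRefl.eval ρ K4.k4PS23 + y123 * PolyRefl.eval ρ K4.k4PS123) * PolyRefl.eval ρ K4.k4PeL) - PolyRefl.eval ρ K4.k4PB * ((y1 * PolyRefl.eval ρ K4.k4PS1 + y13 * PolyRefl.eval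 ρ K4.k4PS13) - (y0 * PolyRefl.eval ρ K4.k4PS0 + y1 * PolyRefl.eval ρ K4.k4PS1 + y2 * PolyRefl.eval ρ K4.k4PS2 + y3 * PolyRefl.eval ρ K4.k4PS3 + y12 * PolyRefl.eval ρ K4.k4PS12 + y13 * PolyRefl.eval ρ K4.k4PS13 + y23 * PolyRefl.eval ρ K4.k4PS23 + y123 * PolyRefl.eval ρ K4.k4PS123) * PolyRefl.eval ρ K4.k4PenL) =
      PolyRefl.eval ρ K4.k4Lam_0_1 * (y1 - y0) + PolyRefl.eval ρ K4.k4Lam_1_12 * (y12 - y1) + PolyRefl.eval ρ K4.k4Lam_2_12 * (y12 - y2) + PolyRefl.eval ρ K4.k4Lam_3_13 * (y13 - y3) + PolyRefl.eval ρ K4.k4Lam_12_123 * (y123 - y12) + PolyRefl.eval ρ K4.k4Lam_13_123 * (y123 - y13) + PolyRefl.eval ρ K4.k4Lam_23_123 * (y123 - y23) := by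
    linear_combination y0 * h0 + y1 * h1 + y2 * h2 + y3 * h3 + y12 * h12 + y13 * h13 + y23 * h23 + y123 * h123
  rw [key]
  exact add_nonneg (add_nonneg (add_nonneg (add_nonneg (add_nonneg (add_nonneg (mul_nonneg hl_0_1 (sub_nonneg.2 hy_0_1)) (mul_nonneg hl_1_12 (sub_nonneg.2 hy_1_12))) (mul_nonneg hl_2_12 (sub_nonneg.2 hy_2_12))) (mul_nonneg hl_3_13 (sub_nonneg.2 hy_3_13))) (mul_nonneg hl_12_123 (sub_nonneg.2 hy_12_123))) (mul_nonneg hl_13_123 (sub_nonneg.2 hy_13_123))) (mul_nonneg hl_23_123 (sub_nonneg.2 hy_23_123))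

end Summit.Ventures.PercRepro2
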